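/-
Copyright (c) 2026. All rights reserved.
Released under Apache 2.0 license as described in the file LICENSE.
-/
import Literature.Probability.FitznerVanDerHofstad2017.NobleBoundsNMidSZero
import Literature.Probability.FitznerVanDerHofstad2017.NobleBoundsNMidSOne
import Literature.Probability.FitznerVanDerHofstad2017.NobleBoundsN1Class01
import HarnessLib

/-!
# Fitzner–van der Hofstad (2017), §6.1 (6.4) / App. B: term-1 packages of a middle junction, variant `F‴`, open exit classes `a′ ∈ {1, 2}` off the corner `w′ = t`

[FvdH17] = R. Fitzner, R. van der Hofstad, *Mean-field behavior for nearest-neighbor percolation in `d > 10`*,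
arXiv:1506.07977v2 (EJP 22 (2017), paper 43).  Page numbers refer to the arXiv version.

Continuation of `NobleBoundsNMidS` (cells `(a, 2, 0)`), `NobleBoundsNMidSZero` (`(a, 0, 0)`) and
`NobleBoundsNMidSOne` (`(a, 1, 0)`): the packages of a MIDDLE junction `k` (`1 ≤ k ≤ M`) of variant `F‴` (kind
`midS`, (4.61), p. 41: lines `v → t`, `t ⇔ z`, `t → w′`, `z → u′`, `w′ → u′`, exit `w′ → z′`) for the cells
`(a, c, a′)` with OPEN exit class `a′ ∈ {1, 2}` of level `k + 1` — `w′ ≠ u′`, and `(w′, u′)` an open bond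
(`a′ = 1`) resp. not an open bond (`a′ = 2`) of `ω_{k+1}` ([FvdH17] §6.1 "Case b = 1 / b ≥ 2", p. 59) — for every
lower exit class `a ∈ {0,1,2}` and inner class `c ∈ {0,1,2}`, in the PARAMETER REGIME `w′ ≠ t`.  The target is the
`c`-summand `A^{κ,a,c,*}(u,w,t,z) · A^{c,a′}(t,z,w′,u′)` of the first term of the pointwise (5.4) (p. 48):

* letter `A^{κ,a,c,*}(u,w,t,z)` (App. B Table "A^{ι,a,b}", p. 75, with `S, T ↦ S*, T*` for `c ≠ 0`): the bond
  `{u ←1̲→ v}` and the exit line `{z ↔ w}` of level `k`, the entry line `{v ↔ t}` and the sausage line `t → z`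
  of level `k + 1` — trivial (`c = 0`), the open bond itself (`c = 1`, normal form `Conds.tzNF`), of length `≥ 2`
  (`c = 2`); row `(a, c) = (0, 0)` against the PRIMED family `blockAiotaSt'` of `NobleBlocksPrime` (the §6.1
  reading `T_{1̲,1,1}(e, x, 0)`, DIVERGENCE D74 (i) of the b2b-lace packet — App. B prints `T_{1,1̲,1}`);
* letter `A^{c,a′}(t,z,w′,u′)` (App. B Table "A^{a,b}", p. 74, rows `b = 1`, `b ≥ 2`; repulsive triangles
  `𝓣_{1,j_{a′},·}(x,y,v)` in the frame `(0,v,x,y) = (t, z, w′, u′)`): the lines `{t ←1→ w′}` (THIS IS WHERE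
  `w′ ≠ t` IS USED — on the corner `w′ = t` every entry of the table vanishes while the piece does not:
  DIVERGENCE D77-R′, LEMMAS ADDENDUM 13 §13.5 κ2; that corner is not treated here), the class-`a′` leg
  `{w′ ←j_{a′}→ u′}` (the open bond itself for `a′ = 1`, normal form `Conds.wyNF_midS`; length `≥ 2` for
  `a′ = 2`), and `{u′ ↔ z}` (length `≥ 1` in the rows `c = 0`, where `z = t ≠ u′`).

§A the App. B rows as letter inequalities; §B the grouping `glMidS12` (letter `xb` = bond + exit + entry slots
`0, 1`; letter `up 2` = slots `2, 3, 4`) and the open-bond normal form of the exit leg; §C readings and the core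
package `nonempty_jPkg_midSOpen_core`; §D the cells: `nonempty_jPkg_midS_zero_open'` (`c = 0`, primed in row
`a = 0`), `nonempty_jPkg_midS_zero_open` (`c = 0`, `a ≠ 0`), `nonempty_jPkg_midS_one_open` (`c = 1`),
`nonempty_jPkg_midS_two_open` (`c = 2`) — each for `a ∈ {0,1,2}`, `a′ ∈ {1,2}`, under `w_{k+1} ≠ t_k`.

Conventions: `d`-generic; nothing is cited as a fact; additive (no existing declaration is changed).  The
junction is written `k = i.castSucc = i₀.succ` (`i i₀ : Fin (M+1)`), as in `NobleBoundsNMidS`.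
-/

noncomputable section

namespace Literature.Probability.FitznerVanDerHofstad2017

open Literature.Barriers.CriticalPhenomena Literature.Probability.Percolation
open Literature.Probability.LatticeModels Literature.Combinatorics.SimpleGraph _root_.SimpleGraph
open _root_.MeasureTheory
open Literature.Probability.FitznerVanDerHofstad2017.NobleBlocks
open Literature.Probability.FitznerVanDerHofstad2017.NobleBlocks.LenIdx
open scoped ENNReal

variable {d : ℕ}

/-! ### A. The App. B rows as letter inequalities -/

section Rows

variable (p : unitInterval)

/-- Row `a = 0, b = 1` of the `A^{ι,a,b,*}` table:
`A^{ι,0,1,*}(0,v,x,y) = δ_{v,0} (1−δ_{y,v}) (δ_{x,e} T*_{1̲,1̲,2}(e,y,0) + S*_{1̲,1,1̲,1}(e,x,y,0))`.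
[cite: FitznerVanDerHofstad2017, App. B Table "definition of A^{ι,a,b}(0,v,x,y)", row a = 0, b = 1, and the sentence after it (arXiv:1506.07977v2 p. 75)] -/
theorem blockAiotaSt₀_zero_one (L : Letters d) (ι : Fin d × Bool) (v x y : Site d) :
    blockAiotaSt₀ L ι 0 1 v x y = kd v 0 * kdc y v *
      (kd x (stepVec ι) * L.Tst (eq 1) (eq 1) (ge 2) (stepVec ι) y 0 +
        L.Sst (eq 1) (ge 1) (eq 1) (ge 1) (stepVec ι) x y 0) := rfl

/-- Row `a = 0, b = 1` of the `A^{a,b}` table: `A^{0,1}(0,v,x,y) = δ_{v,0} (1−δ_{y,v}) T_{1,1̲,1}(x,y,0)`.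
[cite: FitznerVanDerHofstad2017, App. B Table "definition of A^{a,b}(0,v,x,y)", row a = 0, b = 1 (arXiv:1506.07977v2 p. 74)] -/
theorem blockA₀_zero_one (L : Letters d) (v x y : Site d) :
    blockA₀ L 0 1 v x y = kd v 0 * kdc y v * L.T (ge 1) (eq 1) (ge 1) x y 0 := rfl

/-- Row `a = 0, b ≥ 2` of the `A^{a,b}` table: `A^{0,2}(0,v,x,y) = δ_{v,0} (1−δ_{y,0}) (1−δ_{x,0}) T_{1,2,1}(x,y,0)`.
[cite: FitznerVanDerHofstad2017, App. B Table "definition of A^{a,b}(0,v,x,y)", row a = 0, b ≥ 2 (arXiv:1506.07977v2 p. 74)] -/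
theorem blockA₀_zero_two (L : Letters d) (v x y : Site d) :
    blockA₀ L 0 2 v x y = kd v 0 * kdc y 0 * kdc x 0 * L.T (ge 1) (ge 2) (ge 1) x y 0 := rfl

/-- Row `a = 1, b = 1` of the `A^{a,b}` table: `A^{1,1}(0,v,x,y) = 2dD(v) T_{1,1̲,0}(x,y,v)`.
[cite: FitznerVanDerHofstad2017, App. B Table "definition of A^{a,b}(0,v,x,y)", row a = 1, b = 1 (arXiv:1506.07977v2 p. 74)] -/
theorem blockA₀_one_one (L : Letters d) (v x y : Site d) :
    blockA₀ L 1 1 v x y = twoDD v * L.T (ge 1) (eq 1) (ge 0) x y v := rfl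

/-- Row `a = 1, b ≥ 2` of the `A^{a,b}` table: `A^{1,2}(0,v,x,y) = 2dD(v) T_{1,2,0}(x,y,v)`.
[cite: FitznerVanDerHofstad2017, App. B Table "definition of A^{a,b}(0,v,x,y)", row a = 1, b ≥ 2 (arXiv:1506.07977v2 p. 74)] -/
theorem blockA₀_one_two (L : Letters d) (v x y : Site d) :
    blockA₀ L 1 2 v x y = twoDD v * L.T (ge 1) (ge 2) (ge 0) x y v := rfl

/-- Row `a ≥ 2, b = 1` of the `A^{a,b}` table: `A^{2,1}(0,v,x,y) = T_{1,1̲,0}(x,y,v)`.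
[cite: FitznerVanDerHofstad2017, App. B Table "definition of A^{a,b}(0,v,x,y)", row a ≥ 2, b = 1 (arXiv:1506.07977v2 p. 74)] -/
theorem blockA₀_two_one (L : Letters d) (v x y : Site d) :
    blockA₀ L 2 1 v x y = L.T (ge 1) (eq 1) (ge 0) x y v := rfl

/-- **Row `(0,0)` of `A^{ι,a,b,*}` in the §6.1 reading (primed) as a three-line letter on two levels**: for
`w = u`, `z = t` the lines `{u ←1̲→ v}`, `{v ←1→ t}`, `{t ←1→ u}` (`t ≠ v`, `t ≠ u`) are bounded by
`A'^{ι,0,0,*}(u,u,t,t) = T_{1̲,1,1}(v−u, t−u, 0)`.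
[cite: FitznerVanDerHofstad2017, §6.1 "Case a = 0 and b = 0" (arXiv:1506.07977v2 p. 59); App. B (p. 75)] -/
theorem piPerc_midS_zero_zero_le_blockAiotaSt' {ι : Fin d × Bool} {u v t : Site d} (hv : v = u + stepVec ι)
    (htv : t ≠ v) (htu : t ≠ u) (c : Fin 3 → Fin 2) :
    piPerc d p 2 (genDisjOcc ![event (eq 1) u v, event (ge 1) v t, event (ge 1) t u] c) ≤
      blockAiotaSt' (Letters.perc d p) ι 0 0 u u t t := by
  have he : v - u = stepVec ι := by rw [hv, add_sub_cancel_left]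
  have hx : t - u ≠ stepVec ι := by rw [← he]; exact fun h => htv (sub_left_injective h)
  rw [blockAiotaSt', ofBase, blockAiotaSt₀'_zero_zero, sub_self, kd_self, kd_self, kdc_comm,
    kdc_of_ne (sub_ne_zero.2 htu), kdc_of_ne hx, one_mul, one_mul, one_mul, one_mul, ← he]
  have h := piPerc_genDisjOcc_le_T p (eq 1) (ge 1) (ge 1) u v t u c
  rw [sub_self] at h
  exact h

/-- **Row `(0,1)` of `A^{ι,a,b,*}`, sub-row `x = e`, as a three-line letter on two levels**: for `w = u`, `t = v`
the lines `{u ←1̲→ v}`, `{v ←1̲→ z}`, `{z ←2→ u}` (`z ≠ u`) are bounded by `A^{ι,0,1,*}(u,u,v,z)` (its summand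
`δ_{x,e} T*_{1̲,1̲,2}(e,y,0)`).
[cite: FitznerVanDerHofstad2017, §6.1 "Case a = 0", "Case b = 1" (arXiv:1506.07977v2 pp. 58–59); App. B row a = 0, b = 1 (p. 75); §4.2 after (4.17) (p. 36)] -/
theorem piPerc_midS_zero_one_e_le_blockAiotaSt {ι : Fin d × Bool} {u v z : Site d} (hv : v = u + stepVec ι)
    (hzu : z ≠ u) (c : Fin 3 → Fin 2) :
    piPerc d p 2 (genDisjOcc ![event (eq 1) u v, event (eq 1) v z, event (ge 2) z u] c) ≤
      blockAiotaSt (Letters.perc d p) ι 0 1 u u v z := by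
  have he : v - u = stepVec ι := by rw [hv, add_sub_cancel_left]
  rw [blockAiotaSt, ofBase, blockAiotaSt₀_zero_one, sub_self, kd_self, kdc_of_ne (sub_ne_zero.2 hzu), one_mul,
    one_mul, ← he, kd_self, one_mul]
  have h := piPerc_genDisjOcc_le_T p (eq 1) (eq 1) (ge 2) u v z u c
  rw [sub_self] at h
  exact (h.trans (perc_T_le_Tst p _ _ _ _ _ _)).trans le_self_add

/-- **Row `(0,1)` of `A^{ι,a,b,*}`, sub-row `x ≠ e`, as a four-line letter on two levels**: for `w = u`, `t ≠ v`
the lines `{u ←1̲→ v}`, `{v ←1→ t}`, `{t ←1̲→ z}`, `{z ←1→ u}` (`z ≠ u`) are bounded by `A^{ι,0,1,*}(u,u,t,z)`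
(its summand `S*_{1̲,1,1̲,1}(e,x,y,0)`).
[cite: FitznerVanDerHofstad2017, §6.1 "Case a = 0", "Case b = 1" (arXiv:1506.07977v2 pp. 58–59); App. B row a = 0, b = 1 (p. 75); §4.2 after (4.17) (p. 36)] -/
theorem piPerc_midS_zero_one_ne_le_blockAiotaSt {ι : Fin d × Bool} {u v t z : Site d} (hv : v = u + stepVec ι)
    (hzu : z ≠ u) (c : Fin 4 → Fin 2) :
    piPerc d p 2 (genDisjOcc ![event (eq 1) u v, event (ge 1) v t, event (eq 1) t z, event (ge 1) z u] c) ≤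
      blockAiotaSt (Letters.perc d p) ι 0 1 u u t z := by
  have he : v - u = stepVec ι := by rw [hv, add_sub_cancel_left]
  rw [blockAiotaSt, ofBase, blockAiotaSt₀_zero_one, sub_self, kd_self, kdc_of_ne (sub_ne_zero.2 hzu), one_mul,
    one_mul, ← he]
  have h := piPerc_genDisjOcc_le_S p (eq 1) (ge 1) (eq 1) (ge 1) u v t z u c
  rw [sub_self] at h
  exact (h.trans (perc_S_le_Sst p _ _ _ _ _ _ _ _)).trans le_add_self

/-- **Row `(0,1)` of `A^{a,b}` as a three-line letter** (frame base `t`, `v = 0`: `z = t`): the lines `{t ←1→ w′}`,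
`{w′ ←1̲→ u′}`, `{u′ ←1→ t}` on one level (`u′ ≠ t`) are bounded by `A^{0,1}(t,t,w′,u′) = T_{1,1̲,1}(w′−t, u′−t, 0)`.
[cite: FitznerVanDerHofstad2017, App. B Table "definition of A^{a,b}(0,v,x,y)", row a = 0, b = 1 (arXiv:1506.07977v2 p. 74); §4.2 (4.16) (p. 36)] -/
theorem piPerc_midS_zero_one_le_blockA {t w' u' : Site d} (hut : u' ≠ t) (c : Fin 3 → Fin 2) :
    piPerc d p 2 (genDisjOcc ![event (ge 1) t w', event (eq 1) w' u', event (ge 1) u' t] c) ≤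
      blockA (Letters.perc d p) 0 1 t t w' u' := by
  rw [blockA, ofBase, blockA₀_zero_one, sub_self, kd_self, kdc_of_ne (sub_ne_zero.2 hut), one_mul, one_mul]
  have h := piPerc_genDisjOcc_le_T p (ge 1) (eq 1) (ge 1) t w' u' t c
  rw [sub_self] at h
  exact h

/-- **Row `(0,2)` of `A^{a,b}` as a three-line letter** (`z = t`): the lines `{t ←1→ w′}`, `{w′ ←2→ u′}`,
`{u′ ←1→ t}` on one level (`w′, u′ ≠ t`) are bounded by `A^{0,2}(t,t,w′,u′) = T_{1,2,1}(w′−t, u′−t, 0)`.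
[cite: FitznerVanDerHofstad2017, App. B Table "definition of A^{a,b}(0,v,x,y)", row a = 0, b ≥ 2 (arXiv:1506.07977v2 p. 74); §4.2 (4.16) (p. 36)] -/
theorem piPerc_midS_zero_two_le_blockA {t w' u' : Site d} (hwt : w' ≠ t) (hut : u' ≠ t) (c : Fin 3 → Fin 2) :
    piPerc d p 2 (genDisjOcc ![event (ge 1) t w', event (ge 2) w' u', event (ge 1) u' t] c) ≤
      blockA (Letters.perc d p) 0 2 t t w' u' := by
  rw [blockA, ofBase, blockA₀_zero_two, sub_self, kd_self, kdc_of_ne (sub_ne_zero.2 hut),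
    kdc_of_ne (sub_ne_zero.2 hwt), one_mul, one_mul, one_mul]
  have h := piPerc_genDisjOcc_le_T p (ge 1) (ge 2) (ge 1) t w' u' t c
  rw [sub_self] at h
  exact h

/-- **Row `(1,1)` of `A^{a,b}` as a three-line letter**: for `z` a lattice neighbour of `t` the lines `{t ←1→ w′}`,
`{w′ ←1̲→ u′}`, `{u′ ↔ z}` on one level are bounded by `A^{1,1}(t,z,w′,u′) = T_{1,1̲,0}(w′−t, u′−t, z−t)`.
[cite: FitznerVanDerHofstad2017, App. B Table "definition of A^{a,b}(0,v,x,y)", row a = 1, b = 1 (arXiv:1506.07977v2 p. 74); §4.2 (4.16) (p. 36)] -/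
theorem piPerc_midS_one_one_le_blockA {κ' : Fin d × Bool} {t z w' u' : Site d} (hz : z = t + stepVec κ')
    (c : Fin 3 → Fin 2) :
    piPerc d p 2 (genDisjOcc ![event (ge 1) t w', event (eq 1) w' u', event (ge 0) u' z] c) ≤
      blockA (Letters.perc d p) 1 1 t z w' u' := by
  have hk : z - t = stepVec κ' := by rw [hz, add_sub_cancel_left]
  rw [blockA, ofBase, blockA₀_one_one, hk, twoDD_stepVec, one_mul, ← hk]
  exact piPerc_genDisjOcc_le_T p (ge 1) (eq 1) (ge 0) t w' u' z c

/-- **Row `(1,2)` of `A^{a,b}` as a three-line letter**: for `z` a lattice neighbour of `t` the lines `{t ←1→ w′}`,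
`{w′ ←2→ u′}`, `{u′ ↔ z}` on one level are bounded by `A^{1,2}(t,z,w′,u′) = T_{1,2,0}(w′−t, u′−t, z−t)`.
[cite: FitznerVanDerHofstad2017, App. B Table "definition of A^{a,b}(0,v,x,y)", row a = 1, b ≥ 2 (arXiv:1506.07977v2 p. 74); §4.2 (4.16) (p. 36)] -/
theorem piPerc_midS_one_two_le_blockA {κ' : Fin d × Bool} {t z w' u' : Site d} (hz : z = t + stepVec κ')
    (c : Fin 3 → Fin 2) :
    piPerc d p 2 (genDisjOcc ![event (ge 1) t w', event (ge 2) w' u', event (ge 0) u' z] c) ≤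
      blockA (Letters.perc d p) 1 2 t z w' u' := by
  have hk : z - t = stepVec κ' := by rw [hz, add_sub_cancel_left]
  rw [blockA, ofBase, blockA₀_one_two, hk, twoDD_stepVec, one_mul, ← hk]
  exact piPerc_genDisjOcc_le_T p (ge 1) (ge 2) (ge 0) t w' u' z c

/-- **Row `(2,1)` of `A^{a,b}` as a three-line letter**: the lines `{t ←1→ w′}`, `{w′ ←1̲→ u′}`, `{u′ ↔ z}` on one
level are bounded by `A^{2,1}(t,z,w′,u′) = T_{1,1̲,0}(w′−t, u′−t, z−t)`.
[cite: FitznerVanDerHofstad2017, App. B Table "definition of A^{a,b}(0,v,x,y)", row a ≥ 2, b = 1 (arXiv:1506.07977v2 p. 74); §4.2 (4.16) (p. 36)] -/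
theorem piPerc_midS_two_one_le_blockA {t z w' u' : Site d} (c : Fin 3 → Fin 2) :
    piPerc d p 2 (genDisjOcc ![event (ge 1) t w', event (eq 1) w' u', event (ge 0) u' z] c) ≤
      blockA (Letters.perc d p) 2 1 t z w' u' := by
  rw [blockA, ofBase, blockA₀_two_one]
  exact piPerc_genDisjOcc_le_T p (ge 1) (eq 1) (ge 0) t w' u' z c

/-- **Row `(2,2)` of `A^{a,b}` as a three-line letter**: the lines `{t ←1→ w′}`, `{w′ ←2→ u′}`, `{u′ ↔ z}` on one
level are bounded by `A^{2,2}(t,z,w′,u′) = T_{1,2,0}(w′−t, u′−t, z−t)`.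
[cite: FitznerVanDerHofstad2017, App. B Table "definition of A^{a,b}(0,v,x,y)", row a ≥ 2, b ≥ 2 (arXiv:1506.07977v2 p. 74); §4.2 (4.16) (p. 36)] -/
theorem piPerc_midS_two_two_le_blockA {t z w' u' : Site d} (c : Fin 3 → Fin 2) :
    piPerc d p 2 (genDisjOcc ![event (ge 1) t w', event (ge 2) w' u', event (ge 0) u' z] c) ≤
      blockA (Letters.perc d p) 2 2 t z w' u' := by
  rw [blockA, ofBase, NobleBlocks.blockA₀_two_two]
  exact piPerc_genDisjOcc_le_T p (ge 1) (ge 2) (ge 0) t w' u' z c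

end Rows

/-! ### B. The grouping with an open exit leg, and the open-bond normal form of the exit leg -/

/-- The GROUPING of term 1 at a middle junction of variant `F‴` with an open exit class above: letter `xb` =
{bond, lower lines, `up 0`, `up 1`} (`A^{κ,a,c,*}`), letter `up 2` = {`up 2`, `up 3`, `up 4`} (`A^{c,a′}` with its
class-`a′` leg `w′ → u′`). [cite: FitznerVanDerHofstad2017, §5.1 (5.4) first term (arXiv:1506.07977v2 p. 48); App. B (pp. 74–75)] -/
def glMidS12 : JIdx → JIdx
  | .xb => .xb
  | .xtz => .xtz
  | .lo _ => .xb
  | .up j => ![JIdx.xb, .xb, .up 2, .up 2, .up 2, .up 5] j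

section Grouping

variable (M : ℕ) (x : Site d) (b : Fin (M + 2) → Site d × Site d) (w t z : Fin (M + 2) → Site d)
  (a : Fin (M + 2) → Fin 3 ⊕ Unit) (τ : Fin (M + 1) → Bool × Fin 3)

/-- **The grouping `glMidS12` obeys the (4.65) rule**: its only cross-level letter joins lower lines with the
ENTRY slots `0, 1` of the `midS` level `k + 1`. [cite: FitznerVanDerHofstad2017, §4.4 (4.65) and the sentence after it (arXiv:1506.07977v2 p. 43)] -/
theorem glMidS12_entry (i : Fin (M + 1)) (hσ : (τ i).1 = false) {a' : Fin 3} (ha' : a i.succ = Sum.inl a')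
    (j j' : Fin 6) (hg : glMidS12 (.lo j) = glMidS12 (.up j')) :
    IsEntry (pieceViews M x b w t z a τ i.castSucc.succ).kd j' := by
  rw [pieceViews_mid_kd, ha', hσ]
  show (j' : ℕ) < 2
  fin_cases j' <;> simp [glMidS12] at hg ⊢

end Grouping

section MidSFacts

variable {M : ℕ} {x : Site d} {b : Fin (M + 2) → Site d × Site d} {w t z : Fin (M + 2) → Site d}
  {a : Fin (M + 2) → Fin 3 ⊕ Unit} {c : Fin 3 ⊕ Unit} {τ : Fin (M + 1) → Bool × Fin 3}
  {ω : Fin (M + 3) → BondConfig (Site d)} {K₀ : Fin (M + 3) → Fin 6 → Set (Sym2 (Site d))}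

/-- **The open exit bond is its own witness** on a `midS` level `k + 1` of exit class `1`: the witness of the exit
leg (slot `4`, `w′ → u′`) is `{(w′, u′)}`.
[cite: FitznerVanDerHofstad2017, §6.1 proof of Lemma 5.2, Cases a = 1 / b = 1, "we include the information that … are neighbors" (arXiv:1506.07977v2 pp. 58–59); §4.4 after (4.65) (p. 43)] -/
theorem JFacts.wy_witness_midS (h : JFacts M x b w t z a c τ ω K₀) (i : Fin (M + 1)) (hσ : (τ i).1 = false)
    (ha' : a i.succ = Sum.inl 1) : K₀ i.castSucc.succ 4 = {s(w i.succ, (b i.succ).1)} := by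
  have h1 := h.exitClass_one i.succ ha'
  have hk : (pieceViews M x b w t z a τ i.castSucc.succ).kd = .midS := by
    rw [pieceViews_midS M x b w t z a τ i hσ ha']
  have hw := h.conds.wyNF_midS i.castSucc.succ hk
  rw [pieceViews_midS M x b w t z a τ i hσ ha'] at hw
  refine hw h1.1.symm ?_
  rw [Sym2.eq_swap, Fin.succ_castSucc]
  exact h1.2.1

/-- The PARAMETER FACTS of a non-empty `F‴` piece at junction `k` with open exit above, read off `JFacts`.
[cite: FitznerVanDerHofstad2017, (4.61), (4.64) and §6.1 "Case a, b" (arXiv:1506.07977v2 pp. 41–42, 58–59)] -/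
theorem midSOpen_facts (hF : JFacts M x b w t z a c τ ω K₀) (i i₀ : Fin (M + 1)) (hk : i₀.succ = i.castSucc)
    (hσ : (τ i).1 = false) {a₀ a' : Fin 3} (ha : a i.castSucc = Sum.inl a₀) (ha' : a i.succ = Sum.inl a') :
    z i.castSucc ≠ (b i.succ).1 ∧ t i.castSucc ≠ (b i.succ).1 ∧ (b i.castSucc).1 ≠ t i.castSucc ∧
      (b i.castSucc).1 ≠ z i.castSucc ∧ (b i.castSucc).2 ≠ z i.castSucc ∧
      (a₀ = 0 → w i.castSucc = (b i.castSucc).1) ∧ (a₀ = 1 → (zdGraph d).Adj (b i.castSucc).1 (w i.castSucc)) ∧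
      (a' ≠ 0 → w i.succ ≠ (b i.succ).1) ∧ (a' = 2 → s(w i.succ, (b i.succ).1) ∉ ω i.castSucc.succ) ∧
      ((τ i).2 = 0 → t i.castSucc = z i.castSucc) ∧ ((τ i).2 ≠ 0 → t i.castSucc ≠ z i.castSucc) ∧
      ((τ i).2 = 1 → (zdGraph d).Adj (t i.castSucc) (z i.castSucc) ∧ s(t i.castSucc, z i.castSucc) ∈ ω i.castSucc.succ) ∧
      ((τ i).2 = 2 → s(t i.castSucc, z i.castSucc) ∉ ω i.castSucc.succ) := by
  have hv := hF.vac_midS i hσ ha'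
  refine ⟨(hF.canon_midS i hσ ha').1, (hF.canon_midS i hσ ha').2, fun h => hv (by simp [h]),
    fun h => hv (by simp [h]), hF.v_ne_z_of_open i i₀ hk ha, ?_, ?_, ?_, ?_, ?_, ?_, ?_, ?_⟩
  · intro h0; exact hF.w_eq_of_exitClass_zero i.castSucc (ha.trans (by rw [h0]))
  · intro h1; exact (hF.exitClass_one i.castSucc (ha.trans (by rw [h1]))).2.2
  · intro h0; exact (hF.u_ne_w_of_exitClass_ne_zero i.succ ha' h0).symm
  · intro h2
    have h := (hF.exitClass_two i.succ (ha'.trans (by rw [h2]))).2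
    rw [Sym2.eq_swap, Fin.succ_castSucc]
    exact h
  · exact hF.t_eq_z_of_innerClass_zero i
  · exact hF.t_ne_z_of_innerClass_ne_zero i
  · intro h1; exact ⟨(hF.innerClass_one i h1).2.2, (hF.innerClass_one i h1).2.1⟩
  · intro h2; exact (hF.innerClass_two i h2).2

end MidSFacts

/-! ### C. Readings and the core package -/

section Letter

variable (p : unitInterval) (M : ℕ) (x : Site d) (b : Fin (M + 2) → Site d × Site d) (w t z : Fin (M + 2) → Site d)
  (a : Fin (M + 2) → Fin 3 ⊕ Unit) (τ : Fin (M + 1) → Bool × Fin 3)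

/-- **Four-line reading of the letter `xb`** under `glMidS12`: bond (level `k`), `v → t`, `t → z` (level `k + 1`),
exit line (level `k`). [cite: FitznerVanDerHofstad2017, §4.2 (4.18) (arXiv:1506.07977v2 p. 35); §6.1 (6.4) (p. 58)] -/
theorem junF_midSOpen_xb_le₄ (i i₀ : Fin (M + 1)) (hk : i₀.succ = i.castSucc) (hσ : (τ i).1 = false)
    {a₀ a' : Fin 3} (ha : a i.castSucc = Sum.inl a₀) (ha' : a i.succ = Sum.inl a')
    (EB E0 E1 E2 E3 E4 X5 : Set (BondConfig (Site d))) :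
    junF p M x b w t z a τ i.castSucc glMidS12 true false (midEv EB E0 E1 E2 E3 E4 X5) .xb ≤
      piPerc d p 2 (genDisjOcc ![EB, E0, E1, X5] ![0, 1, 1, 0]) := by
  refine junF_le_of_lines p M x b w t z a τ i.castSucc glMidS12 true false _ JIdx.xb
    ![JIdx.xb, .up 0, .up 1, .lo 5] (by decide) (fun m => ?_) ![0, 1, 1, 0] (fun m => by fin_cases m <;> rfl)
    ![EB, E0, E1, X5] (by funext m; fin_cases m <;> rfl)
  fin_cases m
  · exact ⟨rfl, rfl⟩
  · exact ⟨(jMidS_act_up_iff M x b w t z a τ i hσ ha' true false 0).2 (by decide), rfl⟩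
  · exact ⟨(jMidS_act_up_iff M x b w t z a τ i hσ ha' true false 1).2 (by decide), rfl⟩
  · exact ⟨(jMidOpen_act_lo_iff M x b w t z a τ i i₀ hk ha true false 5).2 rfl, rfl⟩

/-- **Three-line reading of the letter `xb`, sausage slot dropped** (`c = 0`: `t = z`).
[cite: FitznerVanDerHofstad2017, §4.2 (4.18) (arXiv:1506.07977v2 p. 35); §6.1 (6.4) (p. 58)] -/
theorem junF_midSOpen_xb_le₃ (i i₀ : Fin (M + 1)) (hk : i₀.succ = i.castSucc) (hσ : (τ i).1 = false)
    {a₀ a' : Fin 3} (ha : a i.castSucc = Sum.inl a₀) (ha' : a i.succ = Sum.inl a')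
    (EB E0 E1 E2 E3 E4 X5 : Set (BondConfig (Site d))) :
    junF p M x b w t z a τ i.castSucc glMidS12 true false (midEv EB E0 E1 E2 E3 E4 X5) .xb ≤
      piPerc d p 2 (genDisjOcc ![EB, E0, X5] ![0, 1, 0]) := by
  refine junF_le_of_lines p M x b w t z a τ i.castSucc glMidS12 true false _ JIdx.xb
    ![JIdx.xb, .up 0, .lo 5] (by decide) (fun m => ?_) ![0, 1, 0] (fun m => by fin_cases m <;> rfl)
    ![EB, E0, X5] (by funext m; fin_cases m <;> rfl)
  fin_cases m
  · exact ⟨rfl, rfl⟩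
  · exact ⟨(jMidS_act_up_iff M x b w t z a τ i hσ ha' true false 0).2 (by decide), rfl⟩
  · exact ⟨(jMidOpen_act_lo_iff M x b w t z a τ i i₀ hk ha true false 5).2 rfl, rfl⟩

/-- **Three-line reading of the letter `xb`, entry slot dropped** (sub-row `x = e` of row `(0,1)`: `t = v`).
[cite: FitznerVanDerHofstad2017, §4.2 (4.18) (arXiv:1506.07977v2 p. 35); §6.1 (6.4) (p. 58)] -/
theorem junF_midSOpen_xb_le₃' (i i₀ : Fin (M + 1)) (hk : i₀.succ = i.castSucc) (hσ : (τ i).1 = false)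
    {a₀ a' : Fin 3} (ha : a i.castSucc = Sum.inl a₀) (ha' : a i.succ = Sum.inl a')
    (EB E0 E1 E2 E3 E4 X5 : Set (BondConfig (Site d))) :
    junF p M x b w t z a τ i.castSucc glMidS12 true false (midEv EB E0 E1 E2 E3 E4 X5) .xb ≤
      piPerc d p 2 (genDisjOcc ![EB, E1, X5] ![0, 1, 0]) := by
  refine junF_le_of_lines p M x b w t z a τ i.castSucc glMidS12 true false _ JIdx.xb
    ![JIdx.xb, .up 1, .lo 5] (by decide) (fun m => ?_) ![0, 1, 0] (fun m => by fin_cases m <;> rfl)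
    ![EB, E1, X5] (by funext m; fin_cases m <;> rfl)
  fin_cases m
  · exact ⟨rfl, rfl⟩
  · exact ⟨(jMidS_act_up_iff M x b w t z a τ i hσ ha' true false 1).2 (by decide), rfl⟩
  · exact ⟨(jMidOpen_act_lo_iff M x b w t z a τ i i₀ hk ha true false 5).2 rfl, rfl⟩

/-- **Three-line reading of the letter `up 2`**: `t → w′` (slot 2), `w′ → u′` (slot 4), `u′ → z` (slot 3, read
backwards), all on level `k + 1`. [cite: FitznerVanDerHofstad2017, §4.2 (4.16) (arXiv:1506.07977v2 p. 36); §6.1 (6.4) (p. 58)] -/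
theorem junF_midSOpen_up_le₃ (i : Fin (M + 1)) (hσ : (τ i).1 = false) {a' : Fin 3} (ha' : a i.succ = Sum.inl a')
    (EB E0 E1 E2 E3 E4 X5 : Set (BondConfig (Site d))) :
    junF p M x b w t z a τ i.castSucc glMidS12 true false (midEv EB E0 E1 E2 E3 E4 X5) (.up 2) ≤
      piPerc d p 2 (genDisjOcc ![E2, E4, E3] ![1, 1, 1]) := by
  refine junF_le_of_lines p M x b w t z a τ i.castSucc glMidS12 true false _ (JIdx.up 2)
    ![JIdx.up 2, .up 4, .up 3] (by decide) (fun m => ?_) ![1, 1, 1] (fun m => by fin_cases m <;> rfl)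
    ![E2, E4, E3] (by funext m; fin_cases m <;> rfl)
  fin_cases m
  · exact ⟨(jMidS_act_up_iff M x b w t z a τ i hσ ha' true false 2).2 (by decide), rfl⟩
  · exact ⟨(jMidS_act_up_iff M x b w t z a τ i hσ ha' true false 4).2 (by decide), rfl⟩
  · exact ⟨(jMidS_act_up_iff M x b w t z a τ i hσ ha' true false 3).2 (by decide), rfl⟩

variable (c : Fin 3 ⊕ Unit)

/-- **The core of the open-exit packages of variant `F‴`**: finitary events `E0 ⊇` the witness of `v → t`,
`E1 ⊇` the witness of `t → z`, `X5 ⊇` the exit witness of level `k`, `E2, E3, E4 ⊇` the witnesses of `t → w′`,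
`z → u′`, `w′ → u′` (on the piece), and bounds of the two letters `xb` and `up 2` give a package with target the
product. [cite: FitznerVanDerHofstad2017, §6.1 (6.4) (arXiv:1506.07977v2 p. 58); §4.4 (4.57)–(4.61), (4.65) (pp. 41, 43)] -/
theorem nonempty_jPkg_midSOpen_core (i i₀ : Fin (M + 1)) (hk : i₀.succ = i.castSucc) (κ : Fin d × Bool)
    (hb : (b i.castSucc).2 = (b i.castSucc).1 + stepVec κ) (hσ : (τ i).1 = false) {a₀ a' : Fin 3}
    (ha : a i.castSucc = Sum.inl a₀) (ha' : a i.succ = Sum.inl a') (E0 E1 E2 E3 E4 X5 : Set (BondConfig (Site d)))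
    (h0 : IsFinitary E0) (h1 : IsFinitary E1) (h2 : IsFinitary E2) (h3 : IsFinitary E3) (h4 : IsFinitary E4)
    (h5 : IsFinitary X5)
    (hmem : ∀ ω K₀, JFacts M x b w t z a c τ ω K₀ →
      K₀ i.castSucc.succ 0 ∈ E0 ∧ K₀ i.castSucc.succ 1 ∈ E1 ∧ K₀ i.castSucc.succ 2 ∈ E2 ∧
        K₀ i.castSucc.succ 3 ∈ E3 ∧ K₀ i.castSucc.succ 4 ∈ E4 ∧ K₀ i.castSucc.castSucc 5 ∈ X5)
    {T₁ T₂ : ℝ≥0∞}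
    (hrow₁ : junF p M x b w t z a τ i.castSucc glMidS12 true false
      (midEv (event (eq 1) (b i.castSucc).1 (b i.castSucc).2) E0 E1 E2 E3 E4 X5) .xb ≤ T₁)
    (hrow₂ : junF p M x b w t z a τ i.castSucc glMidS12 true false
      (midEv (event (eq 1) (b i.castSucc).1 (b i.castSucc).2) E0 E1 E2 E3 E4 X5) (.up 2) ≤ T₂) :
    Nonempty (JPkg p (jctx M x b w t z a τ i.castSucc) (JFacts M x b w t z a c τ) (T₁ * T₂)) := by
  have huv : (b i.castSucc).1 ≠ (b i.castSucc).2 := by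
    rw [hb]; exact (zdGraph_adj_iff_stepVec _ _ |>.2 ⟨κ, rfl⟩).ne
  refine nonempty_jPkg_of_joint p i.castSucc glMidS12 true
    (midEv (event (eq 1) (b i.castSucc).1 (b i.castSucc).2) E0 E1 E2 E3 E4 X5)
    (isFinitary_midEv _ _ _ _ _ _ _ (isFinitary_event _ _ _) h0 h1 h2 h3 h4 h5)
    (fun _ => by rw [midEv_xb]; exact singleton_mem_event_eq_one huv)
    (fun j j' _ _ hg => glMidS12_entry M x b w t z a τ i hσ ha' j j' hg)
    (fun ω K₀ hF => ⟨fun j hj => ?_, fun j hj => ?_⟩) ?_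
  · -- the exit witness of level `k`
    obtain rfl := (jMidOpen_act_lo_iff M x b w t z a τ i i₀ hk ha true false j).1 hj
    rw [midEv_lo_five]
    exact (hmem ω K₀ hF).2.2.2.2.2
  · -- the witnesses of level `k + 1`
    have hj5 : j ≠ 5 := (jMidS_act_up_iff M x b w t z a τ i hσ ha' true false j).1 hj
    obtain ⟨m0, m1, m2, m3, m4, -⟩ := hmem ω K₀ hF
    exact mem_midEv_up _ _ _ _ _ _ _ m0 m1 m2 m3 m4 j hj5
  · -- two genuine letters
    exact (prod_junF_le₂ p M x b w t z a τ i.castSucc glMidS12 true false _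
      (show JIdx.xb ≠ JIdx.up 2 by decide)).trans (mul_le_mul' hrow₁ hrow₂)

end Letter

/-! ### D. The packages of the cells `(a, c, a′)`, `a′ ∈ {1, 2}`, variant `F‴`, off the corner `w′ = t` -/

section Packages

variable (p : unitInterval) (M : ℕ) (x : Site d) (b : Fin (M + 2) → Site d × Site d) (w t z : Fin (M + 2) → Site d)
  (a : Fin (M + 2) → Fin 3 ⊕ Unit) (c : Fin 3 ⊕ Unit) (τ : Fin (M + 1) → Bool × Fin 3)

/-- **The exit letter `A^{c,a′}(t,z,w′,u′)`, `a′ ∈ {1,2}`, off the corner**: memberships of the three upper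
witnesses `t → w′`, `z → u′`, `w′ → u′` in the events of the row and the row inequality, packaged as the data the
core consumes (`E2 = {t ←1→ w′}`, `E3 = {u′ ←j→ z}`, `E4 = {w′ ←j_{a′}→ u′}`).  Uses `w′ ≠ t`.
[cite: FitznerVanDerHofstad2017, §6.1 "Case b = 1 / b ≥ 2" (arXiv:1506.07977v2 p. 59); App. B Table "A^{a,b}" rows b = 1, b ≥ 2 (p. 74)] -/
theorem midSOpen_exitLetter (i : Fin (M + 1)) (hσ : (τ i).1 = false) {a' : Fin 3} (ha' : a i.succ = Sum.inl a')
    (ha'0 : a' ≠ 0) (c₁ : Fin 3) (hwt : w i.succ ≠ t i.castSucc)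
    (hP : t i.castSucc ≠ (b i.succ).1 ∧ (a' ≠ 0 → w i.succ ≠ (b i.succ).1) ∧
      ((τ i).2 = 0 → t i.castSucc = z i.castSucc) ∧
      ((τ i).2 = 1 → (zdGraph d).Adj (t i.castSucc) (z i.castSucc)))
    (hc : (τ i).2 = c₁) :
    ∃ E2 E3 E4 : Set (BondConfig (Site d)), IsFinitary E2 ∧ IsFinitary E3 ∧ IsFinitary E4 ∧
      (∀ ω K₀, JFacts M x b w t z a c τ ω K₀ →
        K₀ i.castSucc.succ 2 ∈ E2 ∧ K₀ i.castSucc.succ 3 ∈ E3 ∧ K₀ i.castSucc.succ 4 ∈ E4) ∧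
      ∀ EB E0 E1 X5, junF p M x b w t z a τ i.castSucc glMidS12 true false (midEv EB E0 E1 E2 E3 E4 X5) (.up 2) ≤
        blockA (Letters.perc d p) c₁ a' (t i.castSucc) (z i.castSucc) (w i.succ) (b i.succ).1 := by
  obtain ⟨hty, hw', hc0, hc1⟩ := hP
  have hwy : w i.succ ≠ (b i.succ).1 := hw' ha'0
  -- the exit-leg event and its witness
  have hleg : ∀ ω K₀, JFacts M x b w t z a c τ ω K₀ →
      K₀ i.castSucc.succ 4 ∈ (event (if a' = 1 then eq 1 else ge 2) (w i.succ) (b i.succ).1 :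
        Set (BondConfig (Site d))) := by
    intro ω K₀ hF
    by_cases h1 : a' = 1
    · rw [if_pos h1, hF.wy_witness_midS i hσ (ha'.trans (by rw [h1]))]
      exact singleton_mem_event_eq_one hwy
    · have h2 : a' = 2 := by
        fin_cases a'
        · exact absurd rfl ha'0
        · exact absurd rfl h1
        · rfl
      obtain ⟨-, -, -, -, h4⟩ := hF.conn_midS i hσ ha'
      have hcl := (hF.exitClass_two i.succ (ha'.trans (by rw [h2]))).2
      rw [Sym2.eq_swap, ← Fin.succ_castSucc] at hcl
      rw [if_neg h1, event_ge]
      exact mem_openConnGe_two_of_notMem h4 hwy fun hm => hcl (hF.witness_subset _ 4 hm)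
  refine ⟨event (ge 1) (t i.castSucc) (w i.succ),
    event (if c₁ = 0 then ge 1 else ge 0) (b i.succ).1 (z i.castSucc),
    event (if a' = 1 then eq 1 else ge 2) (w i.succ) (b i.succ).1,
    isFinitary_event _ _ _, isFinitary_event _ _ _, isFinitary_event _ _ _, fun ω K₀ hF => ⟨?_, ?_, hleg ω K₀ hF⟩,
    fun EB E0 E1 X5 => ?_⟩
  · obtain ⟨-, -, h2, -, -⟩ := hF.conn_midS i hσ ha'
    rw [event_ge]; exact mem_openConnGe_one_of_ne h2 hwt.symm
  · obtain ⟨-, -, -, h3, -⟩ := hF.conn_midS i hσ ha'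
    split_ifs with h0
    · rw [event_comm, event_ge]
      exact mem_openConnGe_one_of_ne h3 (by rw [← hc0 (hc.trans h0)]; exact hty)
    · rw [event_comm, event_ge]; exact mem_openConnGe_zero_of_mem h3
  · refine (junF_midSOpen_up_le₃ p M x b w t z a τ i hσ ha' _ _ _ _ _ _ _).trans ?_
    obtain h1 | h2 : a' = 1 ∨ a' = 2 := by
      fin_cases a'
      · exact absurd rfl ha'0
      · exact Or.inl rfl
      · exact Or.inr rfl
    · subst h1
      rw [if_pos rfl]
      obtain h0 | h1' | h2' : c₁ = 0 ∨ c₁ = 1 ∨ c₁ = 2 := by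
        fin_cases c₁
        · exact Or.inl rfl
        · exact Or.inr (Or.inl rfl)
        · exact Or.inr (Or.inr rfl)
      · subst h0
        rw [if_pos rfl, ← hc0 hc]
        exact piPerc_midS_zero_one_le_blockA p (fun h => hty h.symm) _
      · subst h1'
        rw [if_neg (by decide)]
        obtain ⟨κ', hκ'⟩ := (zdGraph_adj_iff_stepVec _ _).1 (hc1 hc)
        exact piPerc_midS_one_one_le_blockA p hκ' _
      · subst h2'
        rw [if_neg (by decide)]
        exact piPerc_midS_two_one_le_blockA p _
    · subst h2
      rw [if_neg (by decide)]
      obtain h0 | h1' | h2' : c₁ = 0 ∨ c₁ = 1 ∨ c₁ = 2 := by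
        fin_cases c₁
        · exact Or.inl rfl
        · exact Or.inr (Or.inl rfl)
        · exact Or.inr (Or.inr rfl)
      · subst h0
        rw [if_pos rfl, ← hc0 hc]
        exact piPerc_midS_zero_two_le_blockA p hwt (fun h => hty h.symm) _
      · subst h1'
        rw [if_neg (by decide)]
        obtain ⟨κ', hκ'⟩ := (zdGraph_adj_iff_stepVec _ _).1 (hc1 hc)
        exact piPerc_midS_one_two_le_blockA p hκ' _
      · subst h2'
        rw [if_neg (by decide)]
        exact piPerc_midS_two_two_le_blockA p _

/-- The exit-line event of row `a` at a junction whose exit line ends at `z`: `{z ←1→ u}` for `a = 0` (exit from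
`w = u`, `z ≠ u`), `{z ↔ w}` else; membership of the exit witness. [cite: FitznerVanDerHofstad2017, §6.1 "Case a = 0" (arXiv:1506.07977v2 p. 58)] -/
theorem midSOpen_exit_mem {ω : Fin (M + 3) → BondConfig (Site d)} {K₀ : Fin (M + 3) → Fin 6 → Set (Sym2 (Site d))}
    (hF : JFacts M x b w t z a c τ ω K₀) (i i₀ : Fin (M + 1)) (hk : i₀.succ = i.castSucc) {a₀ : Fin 3}
    (ha : a i.castSucc = Sum.inl a₀) (huz : (b i.castSucc).1 ≠ z i.castSucc)
    (hw0 : a₀ = 0 → w i.castSucc = (b i.castSucc).1) :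
    K₀ i.castSucc.castSucc 5 ∈ endX a₀ (b i.castSucc).1 (w i.castSucc) (z i.castSucc) := by
  have h5 := hF.conn_exit i i₀ hk ha
  unfold endX
  split_ifs with h0
  · rw [hw0 h0] at h5
    rw [event_comm, event_ge]
    exact mem_openConnGe_one_of_ne h5 huz
  · rw [event_comm, event_ge]
    exact mem_openConnGe_zero_of_mem h5

/-- **Cells `(a, 0, a′)`, `a ∈ {0,1,2}`, `a′ ∈ {1,2}`, variant `F‴`, off the corner `w′ ≠ t`, against the PRIMED
entry letter** (row `a = 0`: §6.1 reading `T_{1̲,1,1}`): a package with target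
`A'^{κ,a,0,*}(u_k,w_k,t_k,z_k) · A^{0,a′}(t_k,z_k,w_{k+1},u_{k+1})` = the `c = 0` summand of the first term of (5.4).
[cite: FitznerVanDerHofstad2017, §6.1 (6.4), "Case a = 0 / 1 / ≥ 2", "Case b = 0, 1, ≥ 2" (arXiv:1506.07977v2 pp. 58–59); §5.1 (5.4) (p. 48); App. B (pp. 74–75)] -/
theorem nonempty_jPkg_midS_zero_open' (i i₀ : Fin (M + 1)) (hk : i₀.succ = i.castSucc) (κ : Fin d × Bool)
    (hb : (b i.castSucc).2 = (b i.castSucc).1 + stepVec κ) (hσ : (τ i).1 = false) (hc0 : (τ i).2 = 0)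
    (a₀ : Fin 3) (ha : a i.castSucc = Sum.inl a₀) {a' : Fin 3} (ha' : a i.succ = Sum.inl a') (ha'0 : a' ≠ 0)
    (hwt : w i.succ ≠ t i.castSucc) :
    Nonempty (JPkg p (jctx M x b w t z a τ i.castSucc) (JFacts M x b w t z a c τ)
      (blockAiotaSt' (Letters.perc d p) κ a₀ 0 (b i.castSucc).1 (w i.castSucc) (t i.castSucc) (z i.castSucc) *
        blockA (Letters.perc d p) 0 a' (t i.castSucc) (z i.castSucc) (w i.succ) (b i.succ).1)) := by
  -- degenerate parameters: the piece is empty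
  by_cases hP : (t i.castSucc ≠ (b i.succ).1 ∧ (a' ≠ 0 → w i.succ ≠ (b i.succ).1) ∧
      ((τ i).2 = 0 → t i.castSucc = z i.castSucc) ∧ ((τ i).2 = 1 → (zdGraph d).Adj (t i.castSucc) (z i.castSucc))) ∧
      (b i.castSucc).1 ≠ t i.castSucc ∧ (b i.castSucc).1 ≠ z i.castSucc ∧ (b i.castSucc).2 ≠ z i.castSucc ∧
      (a₀ = 0 → w i.castSucc = (b i.castSucc).1) ∧ (a₀ = 1 → (zdGraph d).Adj (b i.castSucc).1 (w i.castSucc))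
  swap
  · refine ⟨JPkg.vacuous p _ _ (fun ω K₀ hF => hP ?_) _⟩
    obtain ⟨-, hty, hut, huz, hvz, hw0, hw1, hw', -, hc0', -, hc1, -⟩ := midSOpen_facts hF i i₀ hk hσ ha ha'
    exact ⟨⟨hty, hw', hc0', fun h => (hc1 h).1⟩, hut, huz, hvz, hw0, hw1⟩
  obtain ⟨hQ, hut, huz, hvz, hw0, hw1⟩ := hP
  have htz : t i.castSucc = z i.castSucc := hQ.2.2.1 hc0
  obtain ⟨E2, E3, E4, f2, f3, f4, hmem₂, hrow₂⟩ :=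
    midSOpen_exitLetter p M x b w t z a c τ i hσ ha' ha'0 0 hwt hQ hc0
  refine nonempty_jPkg_midSOpen_core p M x b w t z a τ c i i₀ hk κ hb hσ ha ha'
    (event (ge 1) (b i.castSucc).2 (t i.castSucc)) Set.univ E2 E3 E4
    (endX a₀ (b i.castSucc).1 (w i.castSucc) (z i.castSucc))
    (isFinitary_event _ _ _) isFinitary_univ f2 f3 f4 (isFinitary_endX _ _ _ _)
    (fun ω K₀ hF => ⟨?_, Set.mem_univ _, (hmem₂ ω K₀ hF).1, (hmem₂ ω K₀ hF).2.1, (hmem₂ ω K₀ hF).2.2,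
      midSOpen_exit_mem M x b w t z a c τ hF i i₀ hk ha huz hw0⟩) ?_ (hrow₂ _ _ _ _)
  · obtain ⟨h0, -⟩ := hF.conn_midS i hσ ha'
    rw [event_ge]; exact mem_openConnGe_one_of_ne h0 (by rw [htz]; exact hvz)
  · refine (junF_midSOpen_xb_le₃ p M x b w t z a τ i i₀ hk hσ ha ha' _ _ _ _ _ _ _).trans ?_
    rw [← htz]
    unfold endX
    split_ifs with h0
    · subst h0
      rw [hw0 rfl]
      exact piPerc_midS_zero_zero_le_blockAiotaSt' p hb (by rw [htz]; exact hvz.symm) (fun h => hut h.symm) _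
    · obtain h1 | h2 : a₀ = 1 ∨ a₀ = 2 := by
        fin_cases a₀
        · exact absurd rfl h0
        · exact Or.inl rfl
        · exact Or.inr rfl
      · subst h1
        obtain ⟨κ', hκ'⟩ := (zdGraph_adj_iff_stepVec _ _).1 (hw1 rfl)
        rw [blockAiotaSt'_of_ne _ _ (fun h => absurd h.1 (by decide))]
        exact piPerc_midS_one_zero_le_blockAiotaSt p hb hκ' (fun h => hut h.symm) _
      · subst h2
        rw [blockAiotaSt'_of_ne _ _ (fun h => absurd h.1 (by decide))]
        exact piPerc_midS_two_zero_le_blockAiotaSt p hb _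

/-- **Cells `(a, 0, a′)`, `a ∈ {1,2}`, `a′ ∈ {1,2}`, variant `F‴`, off the corner**, landed (App. B) family:
target `A^{κ,a,0,*}(u_k,w_k,t_k,z_k) · A^{0,a′}(t_k,z_k,w_{k+1},u_{k+1})`.
[cite: FitznerVanDerHofstad2017, §6.1 (6.4), "Case a = 1 / a ≥ 2", "Case b = 0, 1, ≥ 2" (arXiv:1506.07977v2 pp. 58–59); §5.1 (5.4) (p. 48); App. B (pp. 74–75)] -/
theorem nonempty_jPkg_midS_zero_open (i i₀ : Fin (M + 1)) (hk : i₀.succ = i.castSucc) (κ : Fin d × Bool)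
    (hb : (b i.castSucc).2 = (b i.castSucc).1 + stepVec κ) (hσ : (τ i).1 = false) (hc0 : (τ i).2 = 0)
    (a₀ : Fin 3) (ha0 : a₀ ≠ 0) (ha : a i.castSucc = Sum.inl a₀) {a' : Fin 3} (ha' : a i.succ = Sum.inl a')
    (ha'0 : a' ≠ 0) (hwt : w i.succ ≠ t i.castSucc) :
    Nonempty (JPkg p (jctx M x b w t z a τ i.castSucc) (JFacts M x b w t z a c τ)
      (blockAiotaSt (Letters.perc d p) κ a₀ 0 (b i.castSucc).1 (w i.castSucc) (t i.castSucc) (z i.castSucc) *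
        blockA (Letters.perc d p) 0 a' (t i.castSucc) (z i.castSucc) (w i.succ) (b i.succ).1)) := by
  rw [← blockAiotaSt'_of_ne _ _ (fun h => ha0 h.1)]
  exact nonempty_jPkg_midS_zero_open' p M x b w t z a c τ i i₀ hk κ hb hσ hc0 a₀ ha ha' ha'0 hwt

/-- **Cells `(a, 1, a′)`, `a ∈ {0,1,2}`, `a′ ∈ {1,2}`, variant `F‴`, off the corner `w′ ≠ t`**: a package with
target `A^{κ,a,1,*}(u_k,w_k,t_k,z_k) · A^{1,a′}(t_k,z_k,w_{k+1},u_{k+1})` = the `c = 1` summand of the first term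
of (5.4).  The sausage line of level `k + 1` is the open bond `{t ←1̲→ z}` itself (`Conds.tzNF`); row `a = 0`
splits into `t = b̄` (triangle, exit line of length `≥ 2` by parity) and `t ≠ b̄` (square).
[cite: FitznerVanDerHofstad2017, §6.1 (6.4), "Case a = 0 / 1 / ≥ 2", "Case b = 1" (arXiv:1506.07977v2 pp. 58–59); §5.1 (5.4) (p. 48); App. B (pp. 74–75)] -/
theorem nonempty_jPkg_midS_one_open (i i₀ : Fin (M + 1)) (hk : i₀.succ = i.castSucc) (κ : Fin d × Bool)
    (hb : (b i.castSucc).2 = (b i.castSucc).1 + stepVec κ) (hσ : (τ i).1 = false) (hc1 : (τ i).2 = 1)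
    (a₀ : Fin 3) (ha : a i.castSucc = Sum.inl a₀) {a' : Fin 3} (ha' : a i.succ = Sum.inl a') (ha'0 : a' ≠ 0)
    (hwt : w i.succ ≠ t i.castSucc) :
    Nonempty (JPkg p (jctx M x b w t z a τ i.castSucc) (JFacts M x b w t z a c τ)
      (blockAiotaSt (Letters.perc d p) κ a₀ 1 (b i.castSucc).1 (w i.castSucc) (t i.castSucc) (z i.castSucc) *
        blockA (Letters.perc d p) 1 a' (t i.castSucc) (z i.castSucc) (w i.succ) (b i.succ).1)) := by
  -- degenerate parameters: the piece is empty
  by_cases hP : (t i.castSucc ≠ (b i.succ).1 ∧ (a' ≠ 0 → w i.succ ≠ (b i.succ).1) ∧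
      ((τ i).2 = 0 → t i.castSucc = z i.castSucc) ∧ ((τ i).2 = 1 → (zdGraph d).Adj (t i.castSucc) (z i.castSucc))) ∧
      (b i.castSucc).1 ≠ t i.castSucc ∧ (b i.castSucc).1 ≠ z i.castSucc ∧ (b i.castSucc).2 ≠ z i.castSucc ∧
      (a₀ = 0 → w i.castSucc = (b i.castSucc).1) ∧ (a₀ = 1 → (zdGraph d).Adj (b i.castSucc).1 (w i.castSucc)) ∧
      t i.castSucc ≠ z i.castSucc
  swap
  · refine ⟨JPkg.vacuous p _ _ (fun ω K₀ hF => hP ?_) _⟩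
    obtain ⟨-, hty, hut, huz, hvz, hw0, hw1, hw', -, hc0', hcn, hc1', -⟩ := midSOpen_facts hF i i₀ hk hσ ha ha'
    exact ⟨⟨hty, hw', hc0', fun h => (hc1' h).1⟩, hut, huz, hvz, hw0, hw1, hcn (by rw [hc1]; decide)⟩
  obtain ⟨hQ, hut, huz, hvz, hw0, hw1, htz⟩ := hP
  have hadj : (zdGraph d).Adj (t i.castSucc) (z i.castSucc) := hQ.2.2.2 hc1
  obtain ⟨E2, E3, E4, f2, f3, f4, hmem₂, hrow₂⟩ :=
    midSOpen_exitLetter p M x b w t z a c τ i hσ ha' ha'0 1 hwt hQ hc1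
  -- the open sausage bond is its own witness
  have hbond : ∀ ω K₀, JFacts M x b w t z a c τ ω K₀ →
      K₀ i.castSucc.succ 1 ∈ (event (eq 1) (t i.castSucc) (z i.castSucc) : Set (BondConfig (Site d))) := by
    intro ω K₀ hF
    rw [hF.tz_witness_midS i hσ ha' htz ((midSOpen_facts hF i i₀ hk hσ ha ha').2.2.2.2.2.2.2.2.2.2.2.1 hc1).2]
    exact singleton_mem_event_eq_one htz
  by_cases h0 : a₀ = 0
  · subst h0
    have hwu : w i.castSucc = (b i.castSucc).1 := hw0 rfl
    by_cases hx : t i.castSucc = (b i.castSucc).2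
    · -- sub-row `x = e`: triangle, exit line of length `≥ 2` by parity
      refine nonempty_jPkg_midSOpen_core p M x b w t z a τ c i i₀ hk κ hb hσ ha ha' Set.univ
        (event (eq 1) (t i.castSucc) (z i.castSucc)) E2 E3 E4 (event (ge 2) (z i.castSucc) (b i.castSucc).1)
        isFinitary_univ (isFinitary_event _ _ _) f2 f3 f4 (isFinitary_event _ _ _)
        (fun ω K₀ hF => ⟨Set.mem_univ _, hbond ω K₀ hF, (hmem₂ ω K₀ hF).1, (hmem₂ ω K₀ hF).2.1,
          (hmem₂ ω K₀ hF).2.2, ?_⟩) ?_ (hrow₂ _ _ _ _)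
      · have h5 := hF.conn_exit i i₀ hk ha
        rw [hwu] at h5
        have hadj' : (zdGraph d).Adj (b i.castSucc).1 (b i.castSucc).2 :=
          (zdGraph_adj_iff_stepVec _ _).2 ⟨κ, hb⟩
        have hna : ¬ (zdGraph d).Adj (b i.castSucc).1 (z i.castSucc) :=
          not_adj_of_adj_adj hadj' (by rw [← hx]; exact hadj)
        rw [event_comm, event_ge]
        refine mem_openConnGe_two_of_notMem h5 huz fun hm => hna ?_
        exact (SimpleGraph.mem_edgeSet _).1 (hF.lattice _ (hF.witness_subset _ 5 hm))
      · refine (junF_midSOpen_xb_le₃' p M x b w t z a τ i i₀ hk hσ ha ha' _ _ _ _ _ _ _).trans ?_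
        rw [hwu, hx]
        exact piPerc_midS_zero_one_e_le_blockAiotaSt p hb (fun h => huz h.symm) _
    · -- sub-row `x ≠ e`: square
      refine nonempty_jPkg_midSOpen_core p M x b w t z a τ c i i₀ hk κ hb hσ ha ha'
        (event (ge 1) (b i.castSucc).2 (t i.castSucc)) (event (eq 1) (t i.castSucc) (z i.castSucc)) E2 E3 E4
        (event (ge 1) (z i.castSucc) (b i.castSucc).1)
        (isFinitary_event _ _ _) (isFinitary_event _ _ _) f2 f3 f4 (isFinitary_event _ _ _)
        (fun ω K₀ hF => ⟨?_, hbond ω K₀ hF, (hmem₂ ω K₀ hF).1, (hmem₂ ω K₀ hF).2.1, (hmem₂ ω K₀ hF).2.2, ?_⟩)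
        ?_ (hrow₂ _ _ _ _)
      · obtain ⟨h0', -⟩ := hF.conn_midS i hσ ha'
        rw [event_ge]; exact mem_openConnGe_one_of_ne h0' (fun h => hx h.symm)
      · have h5 := midSOpen_exit_mem M x b w t z a c τ hF i i₀ hk ha huz hw0
        rwa [endX, if_pos rfl] at h5
      · refine (junF_midSOpen_xb_le₄ p M x b w t z a τ i i₀ hk hσ ha ha' _ _ _ _ _ _ _).trans ?_
        rw [hwu]
        exact piPerc_midS_zero_one_ne_le_blockAiotaSt p hb (fun h => huz h.symm) _
  · refine nonempty_jPkg_midSOpen_core p M x b w t z a τ c i i₀ hk κ hb hσ ha ha'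
      (event (ge 0) (b i.castSucc).2 (t i.castSucc)) (event (eq 1) (t i.castSucc) (z i.castSucc)) E2 E3 E4
      (endX a₀ (b i.castSucc).1 (w i.castSucc) (z i.castSucc))
      (isFinitary_event _ _ _) (isFinitary_event _ _ _) f2 f3 f4 (isFinitary_endX _ _ _ _)
      (fun ω K₀ hF => ⟨?_, hbond ω K₀ hF, (hmem₂ ω K₀ hF).1, (hmem₂ ω K₀ hF).2.1, (hmem₂ ω K₀ hF).2.2,
        midSOpen_exit_mem M x b w t z a c τ hF i i₀ hk ha huz hw0⟩) ?_ (hrow₂ _ _ _ _)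
    · obtain ⟨h0', -⟩ := hF.conn_midS i hσ ha'
      rw [event_ge]; exact mem_openConnGe_zero_of_mem h0'
    · refine (junF_midSOpen_xb_le₄ p M x b w t z a τ i i₀ hk hσ ha ha' _ _ _ _ _ _ _).trans ?_
      rw [endX, if_neg h0]
      obtain h1 | h2 : a₀ = 1 ∨ a₀ = 2 := by
        fin_cases a₀
        · exact absurd rfl h0
        · exact Or.inl rfl
        · exact Or.inr rfl
      · subst h1
        obtain ⟨κ', hκ'⟩ := (zdGraph_adj_iff_stepVec _ _).1 (hw1 rfl)
        exact piPerc_midS_one_one_le_blockAiotaSt p hb hκ' _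
      · subst h2
        exact piPerc_midS_two_one_le_blockAiotaSt p hb _

/-- **Cells `(a, 2, a′)`, `a ∈ {0,1,2}`, `a′ ∈ {1,2}`, variant `F‴`, off the corner `w′ ≠ t`**: a package with
target `A^{κ,a,2,*}(u_k,w_k,t_k,z_k) · A^{2,a′}(t_k,z_k,w_{k+1},u_{k+1})` = the `c = 2` summand of the first term
of (5.4).  Inner class `2` upgrades the sausage line to `{t ←2→ z}`.
[cite: FitznerVanDerHofstad2017, §6.1 (6.4), "Case a = 0 / 1 / ≥ 2", "Case b ≥ 2" (arXiv:1506.07977v2 pp. 58–59); §5.1 (5.4) (p. 48); App. B (pp. 74–75)] -/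
theorem nonempty_jPkg_midS_two_open (i i₀ : Fin (M + 1)) (hk : i₀.succ = i.castSucc) (κ : Fin d × Bool)
    (hb : (b i.castSucc).2 = (b i.castSucc).1 + stepVec κ) (hσ : (τ i).1 = false) (hc2 : (τ i).2 = 2)
    (a₀ : Fin 3) (ha : a i.castSucc = Sum.inl a₀) {a' : Fin 3} (ha' : a i.succ = Sum.inl a') (ha'0 : a' ≠ 0)
    (hwt : w i.succ ≠ t i.castSucc) :
    Nonempty (JPkg p (jctx M x b w t z a τ i.castSucc) (JFacts M x b w t z a c τ)
      (blockAiotaSt (Letters.perc d p) κ a₀ 2 (b i.castSucc).1 (w i.castSucc) (t i.castSucc) (z i.castSucc) *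
        blockA (Letters.perc d p) 2 a' (t i.castSucc) (z i.castSucc) (w i.succ) (b i.succ).1)) := by
  -- degenerate parameters: the piece is empty
  by_cases hP : (t i.castSucc ≠ (b i.succ).1 ∧ (a' ≠ 0 → w i.succ ≠ (b i.succ).1) ∧
      ((τ i).2 = 0 → t i.castSucc = z i.castSucc) ∧ ((τ i).2 = 1 → (zdGraph d).Adj (t i.castSucc) (z i.castSucc))) ∧
      (b i.castSucc).1 ≠ t i.castSucc ∧ (b i.castSucc).1 ≠ z i.castSucc ∧ (b i.castSucc).2 ≠ z i.castSucc ∧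
      (a₀ = 0 → w i.castSucc = (b i.castSucc).1) ∧ (a₀ = 1 → (zdGraph d).Adj (b i.castSucc).1 (w i.castSucc)) ∧
      t i.castSucc ≠ z i.castSucc
  swap
  · refine ⟨JPkg.vacuous p _ _ (fun ω K₀ hF => hP ?_) _⟩
    obtain ⟨-, hty, hut, huz, hvz, hw0, hw1, hw', -, hc0', hcn, hc1', -⟩ := midSOpen_facts hF i i₀ hk hσ ha ha'
    exact ⟨⟨hty, hw', hc0', fun h => (hc1' h).1⟩, hut, huz, hvz, hw0, hw1, hcn (by rw [hc2]; decide)⟩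
  obtain ⟨hQ, hut, huz, hvz, hw0, hw1, htz⟩ := hP
  obtain ⟨E2, E3, E4, f2, f3, f4, hmem₂, hrow₂⟩ :=
    midSOpen_exitLetter p M x b w t z a c τ i hσ ha' ha'0 2 hwt hQ hc2
  refine nonempty_jPkg_midSOpen_core p M x b w t z a τ c i i₀ hk κ hb hσ ha ha'
    (event (ge 0) (b i.castSucc).2 (t i.castSucc)) (event (ge 2) (t i.castSucc) (z i.castSucc)) E2 E3 E4
    (endX a₀ (b i.castSucc).1 (w i.castSucc) (z i.castSucc))
    (isFinitary_event _ _ _) (isFinitary_event _ _ _) f2 f3 f4 (isFinitary_endX _ _ _ _)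
    (fun ω K₀ hF => ⟨?_, ?_, (hmem₂ ω K₀ hF).1, (hmem₂ ω K₀ hF).2.1, (hmem₂ ω K₀ hF).2.2,
      midSOpen_exit_mem M x b w t z a c τ hF i i₀ hk ha huz hw0⟩) ?_ (hrow₂ _ _ _ _)
  · obtain ⟨h0, -⟩ := hF.conn_midS i hσ ha'
    rw [event_ge]; exact mem_openConnGe_zero_of_mem h0
  · obtain ⟨-, h1, -⟩ := hF.conn_midS i hσ ha'
    have hcl := (midSOpen_facts hF i i₀ hk hσ ha ha').2.2.2.2.2.2.2.2.2.2.2.2 hc2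
    rw [event_ge]
    exact mem_openConnGe_two_of_notMem h1 htz fun hm => hcl (hF.witness_subset _ 1 hm)
  · refine (junF_midSOpen_xb_le₄ p M x b w t z a τ i i₀ hk hσ ha ha' _ _ _ _ _ _ _).trans ?_
    unfold endX
    split_ifs with h0
    · subst h0
      rw [hw0 rfl]
      exact piPerc_midS_zero_two_le_blockAiotaSt p hb (fun h => hut h.symm) (fun h => huz h.symm) _
    · obtain h1 | h2 : a₀ = 1 ∨ a₀ = 2 := by
        fin_cases a₀
        · exact absurd rfl h0
        · exact Or.inl rfl
        · exact Or.inr rfl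
      · subst h1
        obtain ⟨κ', hκ'⟩ := (zdGraph_adj_iff_stepVec _ _).1 (hw1 rfl)
        exact piPerc_midS_one_two_le_blockAiotaSt p hb hκ' _
      · subst h2
        exact piPerc_midS_two_two_le_blockAiotaSt p hb _

end Packages

end Literature.Probability.FitznerVanDerHofstad2017

end
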